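import Literature.AlgebraicGeometry.Morphisms.GraphFamilyLettersFinite
import Literature.AlgebraicGeometry.AbelianSchemes.PolarizedTupleIsoCanonicalBundle
import Literature.AlgebraicGeometry.AbelianSchemes.AbelianSchemeOverRingAction
import Literature.AlgebraicGeometry.AbelianSchemes.AbelianSchemePolarization
import Literature.AlgebraicGeometry.AbelianSchemes.AbelianSchemeOverLevelBaseChange
import Literature.AlgebraicGeometry.AbelianSchemes.AbelianSchemePolarizationBaseChange
import Literature.AlgebraicGeometry.AbelianSchemes.RigidifiedLineBundleComapHom          -- ★ `baseChangeHom`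
import HarnessLib

/-!
# The Hilbert letters of isomorphisms of polarised tuples lie in a FINITE set (closer of `stub_ILET`)

Layer `Literature/AlgebraicGeometry/AbelianSchemes`, namespace `Literature.AlgebraicGeometry.AbelianSchemes.AbelianSchemeOver`.  THEOREMS ONLY
(no definition, no named fact, no instance, no notation, no `sorry`); universe `0`.  Cell `hodgecm-mathlib` (D-0151), P6 «MOD programme», organ
«stub_ILET» FILE B3 = THE CLOSER BY NAME (B-p10 (g29); road A-p14 (g34) 23:07:17Z) of `stub_ILET` :157 of the SP3-a2 line
`Summits/HodgeConjecture/HodgeConjecture/Cruxes/HLiu418/Lines/F0_P6a_IsomSchemeFiniteType.lean` (ED. 1, commit 87c7f255f54f): the statement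
below has EXACTLY the binders of the stub and its conclusion with the line's `def`s `TupleIsoVia` ∕ `GraphLetters` ∕ `prodEmb` δ-unfolded (a
Lines file is not importable into `Literature`), so the line closes `stub_ILET := AbelianSchemeOver.exists_finset_graphLetters_of_tupleIso …`.
Count-neutral: HC_CM is proved only modulo the printed citations until rung 0 closes.

* `graphBaseChange_comp_prodBaseChangeToProd` — the graph `(1, λ_t)` of the base-changed polarisation composed with the comparison
  `A_t ×_t Â_t → A ×_Y Â` is `pr_A ≫ (1, λ)`.
* `nonempty_LDelta_baseChange_iso` ∕ `nonempty_pullback_fst_LDelta_tensorPow_iso` — hence `L^Δ(λ_t) ≅ L^Δ(λ)|_{A_t}` (Mathlib `pullbackComp` ∕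
  `pullbackCongr`) and `(L^Δ(λ)^{⊗k})|_{A_t} ≅ L^Δ(λ_t)^{⊗k}` (rank one, equal classes).
* **`exists_finset_graphLetters_of_tupleIso`** — ★ `Morphisms.exists_finset_graphLetters_of_pullback_iso` at `Yᵢ := 𝒜ᵢ.X` (flat: smooth),
  `Nᵢ := L^Δ(λᵢ)^{⊗k} = (Grᵢ^*𝒫ᵢ)^{⊗k}`; at a geometric point `t`, a tuple-isomorphism `(G, Ĝ)` is over `t` (`wG`) and gives
  `G^*(L^Δ(λ₂)^{⊗k}|) ≅ L^Δ(λ₁)^{⊗k}|` (★ `nonempty_pullback_LDelta_tensorPow_iso_of_tupleIso` for the base-changed tuples, conjugated by the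
  previous bullet).

## References
* [MumfordFogartyKirwan1994] D. Mumford, J. Fogarty, F. Kirwan, *Geometric Invariant Theory*, 3rd ed. (1994), Ch. 0 §5 (c) (p. 23); Ch. 6 §2
  Prop. 6.10 (p. 121); Ch. 7 §2 Definition 7.2 (p. 129) and Prop. 7.3 (p. 132).
* [EGAIII2] A. Grothendieck, J. Dieudonné, *EGA III₂* (1963), 7.9.11.
* [Hartshorne1977] R. Hartshorne, *Algebraic Geometry* (1977), II Ex. 6.8, III Ex. 4.5, III Thm. 9.9 (p. 261).
-/

set_option autoImplicit false

noncomputable section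

-- `TopCat.Presheaf`/`Scheme.Modules` bookkeeping (as in ★ `Morphisms/GraphFamilyHilbertPolynomial` and the line file).
set_option backward.isDefEq.respectTransparency false

open CategoryTheory CategoryTheory.Limits CategoryTheory.Abelian AlgebraicGeometry Polynomial MonoidalCategory

namespace Literature.AlgebraicGeometry.AbelianSchemes

namespace AbelianSchemeOver

open Literature.AlgebraicGeometry Literature.AlgebraicGeometry.Morphisms
open Literature.AlgebraicGeometry.Modules Literature.AlgebraicGeometry.Modules.SerreTwist
open Literature.Algebra.Homology Literature.Algebra.Homology.LaurentCech Literature.Algebra.Homology.OrderedCech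
open Literature.AlgebraicGeometry.AbelianVarieties Literature.AlgebraicGeometry.Motives

/-! ### §1 `L^Δ` of the base-changed polarisation is the restriction of `L^Δ` -/

section LDeltaBaseChange

variable {Y T : Scheme.{0}} (𝒜 : AbelianSchemeOver Y) (D : 𝒜.DualPair) (pol : 𝒜.Polarization D)
  (Gr : 𝒜.X.left ⟶ 𝒜.prodLeft D.hat) (hGr₁ : Gr ≫ pullback.fst 𝒜.X.hom D.hat.X.hom = 𝟙 _)
  (hGr₂ : Gr ≫ pullback.snd 𝒜.X.hom D.hat.X.hom = pol.lam.left) (t : T ⟶ Y)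
  (Grt : (𝒜.baseChange t).X.left ⟶ (𝒜.baseChange t).prodLeft (D.hatBaseChange t))
  (hGrt₁ : Grt ≫ pullback.fst (𝒜.baseChange t).X.hom (D.hatBaseChange t).X.hom = 𝟙 _)
  (hGrt₂ : Grt ≫ pullback.snd (𝒜.baseChange t).X.hom (D.hatBaseChange t).X.hom = (pol.baseChange t).lam.left)

include hGr₁ hGr₂ hGrt₁ hGrt₂ in
/-- **`(1, λ_t) ≫ (A_t ×_t Â_t → A ×_Y Â) = pr_A ≫ (1, λ)`** (both projections: `pr_A` and `λ_t.left ≫ pr_Â = pr_A ≫ λ.left`, ★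
`Polarization.baseChange_lam_left_comp_fst`). [cite: MumfordFogartyKirwan1994, Ch. 7 §2 Definition 7.2 (p. 129)] -/
theorem graphBaseChange_comp_prodBaseChangeToProd :
    Grt ≫ D.prodBaseChangeToProd t = pullback.fst 𝒜.X.hom t ≫ Gr := by
  apply pullback.hom_ext
  · rw [Category.assoc, D.prodBaseChangeToProd_fst, ← Category.assoc, hGrt₁, Category.id_comp, Category.assoc, hGr₁, Category.comp_id]
  · rw [Category.assoc, D.prodBaseChangeToProd_snd, ← Category.assoc, hGrt₂, Category.assoc, hGr₂]
    exact pol.baseChange_lam_left_comp_fst t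

include hGr₁ hGr₂ hGrt₁ hGrt₂ in
/-- **`L^Δ(λ_t) ≅ L^Δ(λ)|_{A_t}`**: `(1, λ_t)^*cmp^*𝒫 ≅ ((1, λ_t) ≫ cmp)^*𝒫 = (pr_A ≫ (1, λ))^*𝒫 ≅ pr_A^*(1, λ)^*𝒫` (Mathlib `pullbackComp`,
`pullbackCongr`; `𝒫_t = cmp^*𝒫` is ★ `DualPair.baseChange_P` by construction). [cite: MumfordFogartyKirwan1994, Ch. 6 §2 Prop. 6.10 (p. 121)] -/
theorem nonempty_LDelta_baseChange_iso :
    Nonempty ((Scheme.Modules.pullback Grt).obj ((Scheme.Modules.pullback (D.prodBaseChangeToProd t)).obj D.P) ≅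
      (Scheme.Modules.pullback (X := (𝒜.baseChange t).X.left) (pullback.fst 𝒜.X.hom t)).obj
        ((Scheme.Modules.pullback Gr).obj D.P)) :=
  by
  have i1 := (Scheme.Modules.pullbackComp Grt (D.prodBaseChangeToProd t)).app D.P
  have i2 := (Scheme.Modules.pullbackCongr
      (graphBaseChange_comp_prodBaseChangeToProd 𝒜 D pol Gr hGr₁ hGr₂ t Grt hGrt₁ hGrt₂)).app D.P
  have i3 := ((Scheme.Modules.pullbackComp (X := (𝒜.baseChange t).X.left) (pullback.fst 𝒜.X.hom t) Gr).app D.P).symm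
  exact ⟨i1 ≪≫ i2 ≪≫ i3⟩

include hGr₁ hGr₂ hGrt₁ hGrt₂ in
/-- **`(L^Δ(λ)^{⊗k})|_{A_t} ≅ L^Δ(λ_t)^{⊗k}`**: both are rank-one with the class `(pr_A^*[L^Δ(λ)])^k` in `Ȟ¹(A_t, 𝒪^×)` (the previous lemma in
classes; ★ `detClass_pullback`, ★ `detClass_tensorPow`, ★ `nonempty_iso_iff_detClass_eq`). [cite: Hartshorne1977, II Ex. 6.8 and III Ex. 4.5] -/
theorem nonempty_pullback_fst_LDelta_tensorPow_iso (k : ℕ) :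
    Nonempty ((Scheme.Modules.pullback (X := (𝒜.baseChange t).X.left) (pullback.fst 𝒜.X.hom t)).obj
        (tensorPow ((Scheme.Modules.pullback Gr).obj D.P) k) ≅
      tensorPow ((Scheme.Modules.pullback Grt).obj ((Scheme.Modules.pullback (D.prodBaseChangeToProd t)).obj D.P)) k) := by
  obtain ⟨iL⟩ := nonempty_LDelta_baseChange_iso 𝒜 D pol Gr hGr₁ hGr₂ t Grt hGrt₁ hGrt₂
  have hL : HasRank ((Scheme.Modules.pullback Gr).obj D.P) 1 := hasRank_pullback Gr D.hasRank_one
  have hLf : IsFiniteLocallyFree ((Scheme.Modules.pullback Gr).obj D.P) := HasRank.isFiniteLocallyFree' hL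
  have hLt : HasRank ((Scheme.Modules.pullback Grt).obj ((Scheme.Modules.pullback (D.prodBaseChangeToProd t)).obj D.P)) 1 :=
    hasRank_pullback Grt (hasRank_pullback _ D.hasRank_one)
  have hLtf : IsFiniteLocallyFree ((Scheme.Modules.pullback Grt).obj ((Scheme.Modules.pullback (D.prodBaseChangeToProd t)).obj D.P)) :=
    HasRank.isFiniteLocallyFree' hLt
  have hcl : detClass hLtf = detClass (hLf.pullback (X := (𝒜.baseChange t).X.left) (pullback.fst 𝒜.X.hom t)) :=
    detClass_eq_of_iso iL _ _
  have h1 : HasRank ((Scheme.Modules.pullback (X := (𝒜.baseChange t).X.left) (pullback.fst 𝒜.X.hom t)).obj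
      (tensorPow ((Scheme.Modules.pullback Gr).obj D.P) k)) 1 := hasRank_pullback _ (hasRank_tensorPow_one hL k)
  refine (nonempty_iso_iff_detClass_eq h1 (hasRank_tensorPow_one hLt k)
    ((isFiniteLocallyFree_tensorPow hLf k).pullback (X := (𝒜.baseChange t).X.left) (pullback.fst 𝒜.X.hom t))
    (isFiniteLocallyFree_tensorPow hLtf k)).2 ?_
  rw [detClass_pullback (hE := isFiniteLocallyFree_tensorPow hLf k), detClass_tensorPow hL hLf k, map_pow, detClass_tensorPow hLt hLtf k, hcl,
    detClass_pullback (hE := hLf)]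

end LDeltaBaseChange

/-! ### §2 The closer of `stub_ILET` -/

section Closer

variable {O : Type} [CommRing O] {Y : Scheme.{0}} [IsNoetherian Y]
  (𝒜₁ : AbelianSchemeOver Y) (ρ₁ : 𝒜₁.RingAction O) (D₁ : 𝒜₁.DualPair) (pol₁ : 𝒜₁.Polarization D₁)
  {g N : ℕ} (lvl₁ : 𝒜₁.LevelStructure g N)
  (𝒜₂ : AbelianSchemeOver Y) (ρ₂ : 𝒜₂.RingAction O) (D₂ : 𝒜₂.DualPair) (pol₂ : 𝒜₂.Polarization D₂)
  (lvl₂ : 𝒜₂.LevelStructure g N)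
  (Gr₁ : 𝒜₁.X.left ⟶ 𝒜₁.prodLeft D₁.hat) (Gr₂ : 𝒜₂.X.left ⟶ 𝒜₂.prodLeft D₂.hat)
  {n k : ℕ}
  (j₁ : 𝒜₁.X.left ⟶ Morphisms.projectiveSpace (Fin n) Y) (hj₁ : j₁ ≫ Morphisms.projectiveSpaceFst (Fin n) Y = 𝒜₁.X.hom)
  (j₂ : 𝒜₂.X.left ⟶ Morphisms.projectiveSpace (Fin n) Y) (hj₂ : j₂ ≫ Morphisms.projectiveSpaceFst (Fin n) Y = 𝒜₂.X.hom)

/-- **THE HILBERT LETTERS OF TUPLE-ISOMORPHISMS LIE IN A FINITE SET** (= `stub_ILET` of the SP3-a2 line, binders and conclusion VERBATIM with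
`TupleIsoVia` ∕ `GraphLetters` ∕ `prodEmb` unfolded).  There is a FINITE `F ⊆ ℚ[X] × ℚ[X]` such that for every geometric point `t` of `Y` and every
tuple-isomorphism `(G, Ĝ)` at `t` (levels along `𝟙`, duals along `𝟙`, `G, Ĝ` over `t` with `(G × Ĝ)^*𝒫₂ ≅ 𝒫₁`, `λ₁ ≫ Ĝ = G ≫ λ₂`, `O`-equivariance),
some `(Q, Q′) ∈ F` has: every graph family of `G` through the Segre product embedding `prodEmb j₁ j₂` has the letters `Q` at every field point, and
every graph family of every two-sided inverse `Ginv` through `prodEmb j₂ j₁` the letters `Q′`.  PROOF: ★ `exists_finset_graphLetters_of_pullback_iso`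
(`Yᵢ := 𝒜ᵢ.X` flat by smoothness, `Nᵢ := (Grᵢ^*𝒫ᵢ)^{⊗k}` of rank one, `𝒪_{jᵢ}(1) ≅ Nᵢ` the binders `eᵢ`); `G` is over `t` by `wG`; the iso
`G^*(N₂|) ≅ N₁|` is ★ `nonempty_pullback_LDelta_tensorPow_iso_of_tupleIso` for the base-changed tuples (graphs `(1, λᵢ,ₜ)`) conjugated by §1.
[cite: MumfordFogartyKirwan1994, Ch. 0 §5 (c) (p. 23) and Ch. 7 §2 Prop. 7.3 (p. 132)] [cite: EGAIII2, 7.9.11] -/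
theorem exists_finset_graphLetters_of_tupleIso
    (hn : 1 ≤ n)
    (hGr₁₁ : Gr₁ ≫ pullback.fst 𝒜₁.X.hom D₁.hat.X.hom = 𝟙 _) (hGr₁₂ : Gr₁ ≫ pullback.snd 𝒜₁.X.hom D₁.hat.X.hom = pol₁.lam.left)
    (hGr₂₁ : Gr₂ ≫ pullback.fst 𝒜₂.X.hom D₂.hat.X.hom = 𝟙 _) (hGr₂₂ : Gr₂ ≫ pullback.snd 𝒜₂.X.hom D₂.hat.X.hom = pol₂.lam.left)
    (hj₁c : IsClosedImmersion j₁) (hj₂c : IsClosedImmersion j₂)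
    (e₁ : twistMod (j₁ ≫ pullback.snd (terminal.from Y) (terminal.from (Morphisms.projectiveSpaceInt (Fin n)))) (unitModule _) 1 ≅
      tensorPow ((Scheme.Modules.pullback Gr₁).obj D₁.P) k)
    (e₂ : twistMod (j₂ ≫ pullback.snd (terminal.from Y) (terminal.from (Morphisms.projectiveSpaceInt (Fin n)))) (unitModule _) 1 ≅
      tensorPow ((Scheme.Modules.pullback Gr₂).obj D₂.P) k) : ∃ F : Finset (ℚ[X] × ℚ[X]),
    ∀ ⦃Ω : Type⦄ [Field Ω] [IsAlgClosed Ω] (t : Spec (CommRingCat.of Ω) ⟶ Y)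
      (G : (𝒜₁.baseChange t).X.left ⟶ (𝒜₂.baseChange t).X.left)
      (Ĝ : (D₁.baseChange t).hat.X.left ⟶ (D₂.baseChange t).hat.X.left),
      ((lvl₁.baseChange t).IsBaseChangeVia (lvl₂.baseChange t) (𝟙 _) G ∧
        (D₁.baseChange t).hat.IsBaseChangeVia (D₂.baseChange t).hat (𝟙 _) Ĝ ∧
        (∃ (wG : (𝒜₁.baseChange t).X.hom ≫ 𝟙 _ = G ≫ (𝒜₂.baseChange t).X.hom)
            (wĜ : (D₁.baseChange t).hat.X.hom ≫ 𝟙 _ = Ĝ ≫ (D₂.baseChange t).hat.X.hom),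
          Nonempty ((Scheme.Modules.pullback
              (pullback.map (𝒜₁.baseChange t).X.hom (D₁.baseChange t).hat.X.hom
                (𝒜₂.baseChange t).X.hom (D₂.baseChange t).hat.X.hom G Ĝ (𝟙 _) wG wĜ)).obj (D₂.baseChange t).P ≅
            (D₁.baseChange t).P)) ∧
        (pol₁.baseChange t).lam.left ≫ Ĝ = G ≫ (pol₂.baseChange t).lam.left ∧
        ∀ a : O, (AbelianSchemeOver.baseChangeHom (ρ₁.i a) t).left ≫ G =
          G ≫ (AbelianSchemeOver.baseChangeHom (ρ₂.i a) t).left) →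
      ∃ QQ' ∈ F,
        (∀ (hw : pullback.fst 𝒜₁.X.hom t ≫ 𝒜₁.X.hom = (G ≫ pullback.fst 𝒜₂.X.hom t) ≫ 𝒜₂.X.hom)
            (iΓ : pullback 𝒜₁.X.hom t ⟶ Morphisms.projectiveSpace (Fin (n * n + n + n)) (Spec (CommRingCat.of Ω))),
          iΓ ≫ Morphisms.projectiveSpaceFst (Fin (n * n + n + n)) (Spec (CommRingCat.of Ω)) = pullback.snd 𝒜₁.X.hom t →
          iΓ ≫ Morphisms.projectiveSpaceMap (Fin (n * n + n + n)) t =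
            pullback.lift (pullback.fst 𝒜₁.X.hom t) (G ≫ pullback.fst 𝒜₂.X.hom t) hw ≫
              (MonoidalCategoryStruct.tensorHom
                  (Over.homMk j₁ hj₁ : 𝒜₁.X ⟶ Over.mk (Morphisms.projectiveSpaceFst (Fin n) Y))
                  (Over.homMk j₂ hj₂ : 𝒜₂.X ⟶ Over.mk (Morphisms.projectiveSpaceFst (Fin n) Y)) ≫
                Morphisms.segreOver Y (Morphisms.segreIndexEquivFin n n)).left →
          ∀ ⦃K : Type⦄ [Field K] ⦃X' : Scheme.{0}⦄ (k : X' ⟶ pullback 𝒜₁.X.hom t) (f₀ : X' ⟶ Spec (CommRingCat.of K))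
            (x : Spec (CommRingCat.of K) ⟶ Spec (CommRingCat.of Ω)),
            IsPullback k f₀ (iΓ ≫ Morphisms.projectiveSpaceFst (Fin (n * n + n + n)) (Spec (CommRingCat.of Ω))) x →
            ∀ e : ℕ, regularityBound (preHilbertPoly ℚ (Nat.card (Fin (n * n + n + n))) 0) 0
                (preHilbertPoly ℚ (Nat.card (Fin (n * n + n + n))) 0 - QQ'.1) - 1 ≤ (e : ℤ) →
              Subsingleton (CategoryTheory.Abelian.Ext.{1} (unitModule X') ((Scheme.Modules.pullback k).obj
                (twistMod (iΓ ≫ pullback.snd (terminal.from (Spec (CommRingCat.of Ω)))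
                  (terminal.from (Morphisms.projectiveSpaceInt (Fin (n * n + n + n))))) (unitModule _) e)) 1) ∧
              ((Module.finrank Γ(Spec (CommRingCat.of K), ⊤) (SecMod ((Scheme.Modules.pullback k).obj
                (twistMod (iΓ ≫ pullback.snd (terminal.from (Spec (CommRingCat.of Ω)))
                  (terminal.from (Morphisms.projectiveSpaceInt (Fin (n * n + n + n))))) (unitModule _) e))
                f₀.appTop.hom ⊤) : ℕ) : ℚ) = QQ'.1.eval (e : ℚ)) ∧
        ∀ Ginv : (𝒜₂.baseChange t).X.left ⟶ (𝒜₁.baseChange t).X.left, Ginv ≫ G = 𝟙 _ → G ≫ Ginv = 𝟙 _ →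
          ∀ (hw : pullback.fst 𝒜₂.X.hom t ≫ 𝒜₂.X.hom = (Ginv ≫ pullback.fst 𝒜₁.X.hom t) ≫ 𝒜₁.X.hom)
            (iΓ : pullback 𝒜₂.X.hom t ⟶ Morphisms.projectiveSpace (Fin (n * n + n + n)) (Spec (CommRingCat.of Ω))),
          iΓ ≫ Morphisms.projectiveSpaceFst (Fin (n * n + n + n)) (Spec (CommRingCat.of Ω)) = pullback.snd 𝒜₂.X.hom t →
          iΓ ≫ Morphisms.projectiveSpaceMap (Fin (n * n + n + n)) t =
            pullback.lift (pullback.fst 𝒜₂.X.hom t) (Ginv ≫ pullback.fst 𝒜₁.X.hom t) hw ≫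
              (MonoidalCategoryStruct.tensorHom
                  (Over.homMk j₂ hj₂ : 𝒜₂.X ⟶ Over.mk (Morphisms.projectiveSpaceFst (Fin n) Y))
                  (Over.homMk j₁ hj₁ : 𝒜₁.X ⟶ Over.mk (Morphisms.projectiveSpaceFst (Fin n) Y)) ≫
                Morphisms.segreOver Y (Morphisms.segreIndexEquivFin n n)).left →
          ∀ ⦃K : Type⦄ [Field K] ⦃X' : Scheme.{0}⦄ (k : X' ⟶ pullback 𝒜₂.X.hom t) (f₀ : X' ⟶ Spec (CommRingCat.of K))
            (x : Spec (CommRingCat.of K) ⟶ Spec (CommRingCat.of Ω)),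
            IsPullback k f₀ (iΓ ≫ Morphisms.projectiveSpaceFst (Fin (n * n + n + n)) (Spec (CommRingCat.of Ω))) x →
            ∀ e : ℕ, regularityBound (preHilbertPoly ℚ (Nat.card (Fin (n * n + n + n))) 0) 0
                (preHilbertPoly ℚ (Nat.card (Fin (n * n + n + n))) 0 - QQ'.2) - 1 ≤ (e : ℤ) →
              Subsingleton (CategoryTheory.Abelian.Ext.{1} (unitModule X') ((Scheme.Modules.pullback k).obj
                (twistMod (iΓ ≫ pullback.snd (terminal.from (Spec (CommRingCat.of Ω)))
                  (terminal.from (Morphisms.projectiveSpaceInt (Fin (n * n + n + n))))) (unitModule _) e)) 1) ∧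
              ((Module.finrank Γ(Spec (CommRingCat.of K), ⊤) (SecMod ((Scheme.Modules.pullback k).obj
                (twistMod (iΓ ≫ pullback.snd (terminal.from (Spec (CommRingCat.of Ω)))
                  (terminal.from (Morphisms.projectiveSpaceInt (Fin (n * n + n + n))))) (unitModule _) e))
                f₀.appTop.hom ⊤) : ℕ) : ℚ) = QQ'.2.eval (e : ℚ) := by
  classical
  haveI := hj₁c
  haveI := hj₂c
  haveI : Smooth 𝒜₁.X.hom := 𝒜₁.isSmooth
  haveI : Smooth 𝒜₂.X.hom := 𝒜₂.isSmooth
  haveI : Flat 𝒜₁.X.hom := inferInstance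
  haveI : Flat 𝒜₂.X.hom := inferInstance
  have hN₁ : HasRank (tensorPow ((Scheme.Modules.pullback Gr₁).obj D₁.P) k) 1 :=
    hasRank_tensorPow_one (hasRank_pullback Gr₁ D₁.hasRank_one) k
  have hN₂ : HasRank (tensorPow ((Scheme.Modules.pullback Gr₂).obj D₂.P) k) 1 :=
    hasRank_tensorPow_one (hasRank_pullback Gr₂ D₂.hasRank_one) k
  obtain ⟨F, hF⟩ := Morphisms.exists_finset_graphLetters_of_pullback_iso 𝒜₁.X 𝒜₂.X hn j₁ hj₁ j₂ hj₂ hN₁ hN₂ e₁ e₂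
  refine ⟨F, fun Ω _ _ t G Ĝ hT ↦ ?_⟩
  obtain ⟨-, -, ⟨wG, wĜ, hP⟩, hlam, -⟩ := hT
  -- the graphs `(1, λᵢ,ₜ)` of the base-changed polarisations
  obtain ⟨Gt₁, hGt₁₁, hGt₁₂⟩ : ∃ Gt : (𝒜₁.baseChange t).X.left ⟶ (𝒜₁.baseChange t).prodLeft (D₁.hatBaseChange t),
      Gt ≫ pullback.fst (𝒜₁.baseChange t).X.hom (D₁.hatBaseChange t).X.hom = 𝟙 _ ∧
      Gt ≫ pullback.snd (𝒜₁.baseChange t).X.hom (D₁.hatBaseChange t).X.hom = (pol₁.baseChange t).lam.left :=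
    ⟨pullback.lift (𝟙 _) (pol₁.baseChange t).lam.left (by rw [Category.id_comp]; exact (Over.w (pol₁.baseChange t).lam).symm),
      pullback.lift_fst _ _ _, pullback.lift_snd _ _ _⟩
  obtain ⟨Gt₂, hGt₂₁, hGt₂₂⟩ : ∃ Gt : (𝒜₂.baseChange t).X.left ⟶ (𝒜₂.baseChange t).prodLeft (D₂.hatBaseChange t),
      Gt ≫ pullback.fst (𝒜₂.baseChange t).X.hom (D₂.hatBaseChange t).X.hom = 𝟙 _ ∧
      Gt ≫ pullback.snd (𝒜₂.baseChange t).X.hom (D₂.hatBaseChange t).X.hom = (pol₂.baseChange t).lam.left :=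
    ⟨pullback.lift (𝟙 _) (pol₂.baseChange t).lam.left (by rw [Category.id_comp]; exact (Over.w (pol₂.baseChange t).lam).symm),
      pullback.lift_fst _ _ _, pullback.lift_snd _ _ _⟩
  -- `G^*L^Δ(λ₂,ₜ)^{⊗k} ≅ L^Δ(λ₁,ₜ)^{⊗k}` (★ ICAN) conjugated by `L^Δ(λᵢ)^{⊗k}| ≅ L^Δ(λᵢ,ₜ)^{⊗k}` (§1)
  obtain ⟨ican⟩ := nonempty_pullback_LDelta_tensorPow_iso_of_tupleIso (D₁.baseChange t) (D₂.baseChange t)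
    (pol₁.baseChange t).lam.left (pol₂.baseChange t).lam.left Gt₁ hGt₁₁ hGt₁₂ Gt₂ hGt₂₁ hGt₂₂ G Ĝ wG wĜ hlam hP k
  obtain ⟨i₁⟩ := nonempty_pullback_fst_LDelta_tensorPow_iso 𝒜₁ D₁ pol₁ Gr₁ hGr₁₁ hGr₁₂ t Gt₁ hGt₁₁ hGt₁₂ k
  obtain ⟨i₂⟩ := nonempty_pullback_fst_LDelta_tensorPow_iso 𝒜₂ D₂ pol₂ Gr₂ hGr₂₁ hGr₂₂ t Gt₂ hGt₂₁ hGt₂₂ k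
  have hG : G ≫ pullback.snd 𝒜₂.X.hom t = pullback.snd 𝒜₁.X.hom t := wG.symm.trans (Category.comp_id _)
  exact hF t G hG ⟨(Scheme.Modules.pullback G).mapIso i₂ ≪≫ ican ≪≫ i₁.symm⟩

end Closer

end AbelianSchemeOver

end Literature.AlgebraicGeometry.AbelianSchemes

end
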